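import Summits.ValiantsHypothesis.ValiantsHypothesis.Theorems.SymPencilPerFourInnerRankTenFamily

/-!
# Route `SymPencil` — inner rank of the `2 | 2` row split of `per_4` on a SUBSPACE of the
# `u`-side, I: the family step (`--supports` stmt-ValiantsHypothesis-5674 `SdcSuperquadratic`;
# toward IR9U/IR9H = cell `(9, 7, 8)` of the size-`27` table; rung currency only)

This is the `u`-RESTRICTED version of `SymPencilPerFourInnerRankTenFamily`: a joint family
`Σ_{r ∈ ι} c_r t_r(u, y)² = per (u.1; u.2; y₂; y₃)` (`hJ`) assumed only for `u` in a submodule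
`U` of `K⁴ × K⁴` (and all `y = (y₂, y₃) ∈ K⁴ × K⁴`), with `t_r` bilinear, `c_r ≠ 0`, `|ι| ≤ 9`.
The `y`-side linear algebra of the full-space proof is untouched; what changes is WHERE we may
evaluate in `u`:

* `polar_U` — polarisation in `y` at a point `u ∈ U`;
* `per_rows_kk` — `per (x; y; k; k) = -2βγ (x₀ y₁ + x₁ y₀)` for `k = β e₂ - γ e₃`;
* **`family_step_U`** — at `u = (a, β e₂ + γ e₃) ∈ U` with `a₀ a₁ β γ (a₂ γ + a₃ β) ≠ 0`, GIVEN a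
  derivative direction `δ ∈ U` with `δ.2 0 = 1`, `δ.2 1 = 0` (in the full space this was
  `(0, e₀)`): either `t_r(u, (k, 0)) = 0 ∀ r` or `t_r(u, (0, k)) = 0 ∀ r`.  Differentiating `hJ`
  along `δ` gives `α α' (per (a; δ.2; k; k) + per (δ.1; b; k; k)) = 0`, the bracket being `-2 a₁ β γ`;
* **`family₂₃_U`** — the alternative holds uniformly on `U ∩ {u.2 ∈ span(e₂, e₃)}`
  (`forall_eq_zero_or_of_mul₃` on the submodule `S = φ⁻¹(U)` of the parameter space), provided ONE
  good point of that section is given (the non-degeneracy polynomial does not vanish on it);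
* `columns_of_caseA_U` / `columns_of_caseB_U` — column bookkeeping relative to a linear SECTION
  `ρ : K⁴ → U` of the second projection (`(ρ b).2 = b`): `t_r((a, 0), (e₂, 0)) = 0` etc.

Honest framing: lemmas toward IR9U; cell `(9,7,8)` not killed here; `27 ≤ sdc(per_4) ≤ 29`
unchanged; the crux `SdcSuperquadratic` and `VP ≠ VNP` untouched.  No definitions. [folklore]
-/

noncomputable section

-- single-conjunct layout: Sub = Summit, duplicated namespace component intended
set_option linter.dupNamespace false

namespace Summit.ValiantsHypothesis.ValiantsHypothesis.Theorems.SymPencilPerFourInnerRankHypFamily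

open Matrix Finset Module Polynomial
open Summit.ValiantsHypothesis.ValiantsHypothesis.Theorems.SymPencilPerFourHessianMinors
open Summit.ValiantsHypothesis.ValiantsHypothesis.Theorems.SymPencilPerFourInnerRankRows
open Summit.ValiantsHypothesis.ValiantsHypothesis.Theorems.SymPencilPerFourInnerRankKernel

variable {K : Type*} [Field K] {ι : Type*} [Fintype ι]

/-! ### One more row identity -/

/-- `per (x; y; k; k) = -2 β γ (x₀ y₁ + x₁ y₀)` for `k = β e₂ - γ e₃` (the general form of
`per_family_deriv`). [folklore] -/
theorem per_rows_kk (x y : Fin 4 → K) (β γ : K) :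
    (Matrix.of ![x, y, β • Pi.single (2 : Fin 4) (1 : K) - γ • Pi.single 3 1,
      β • Pi.single (2 : Fin 4) (1 : K) - γ • Pi.single 3 1]).permanent =
      -(2 * β * γ * (x 0 * y 1 + x 1 * y 0)) := by
  rw [permanent_of_rows]
  simp
  ring

/-! ### Polarisation at a point of `U` -/

/-- **Polarisation of the joint identity in `y`, at a point `u ∈ U`.** [folklore] -/
theorem polar_U (c : ι → K)
    (t : ι → (((Fin 4 → K) × (Fin 4 → K)) →ₗ[K] ((Fin 4 → K) × (Fin 4 → K)) →ₗ[K] K))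
    (U : Submodule K ((Fin 4 → K) × (Fin 4 → K)))
    (hJ : ∀ u ∈ U, ∀ y₂ y₃ : Fin 4 → K,
      ∑ r, c r * (t r u (y₂, y₃)) ^ 2 = (Matrix.of ![u.1, u.2, y₂, y₃]).permanent)
    (u : (Fin 4 → K) × (Fin 4 → K)) (hu : u ∈ U) (y₂ y₃ y₂' y₃' : Fin 4 → K) :
    2 * ∑ r, c r * t r u (y₂, y₃) * t r u (y₂', y₃') =
      (Matrix.of ![u.1, u.2, y₂, y₃']).permanent + (Matrix.of ![u.1, u.2, y₂', y₃]).permanent := by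
  have h1 := hJ u hu (y₂ + y₂') (y₃ + y₃')
  have h2 := hJ u hu y₂ y₃
  have h3 := hJ u hu y₂' y₃'
  have hsplit : ∀ r, t r u (y₂ + y₂', y₃ + y₃') = t r u (y₂, y₃) + t r u (y₂', y₃') :=
    fun r => by rw [← map_add]; rfl
  simp_rw [hsplit] at h1
  rw [per_add_row₂, per_add_row₃, per_add_row₃] at h1
  have hsq : ∑ r, c r * (t r u (y₂, y₃) + t r u (y₂', y₃')) ^ 2 =
      ∑ r, c r * (t r u (y₂, y₃)) ^ 2 +
        2 * ∑ r, c r * t r u (y₂, y₃) * t r u (y₂', y₃') +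
        ∑ r, c r * (t r u (y₂', y₃')) ^ 2 := by
    rw [Finset.mul_sum, ← Finset.sum_add_distrib, ← Finset.sum_add_distrib]
    exact Finset.sum_congr rfl fun r _ => by ring
  linear_combination h1 - h2 - h3 - hsq

/-! ### The family step at a point of `U` -/

/-- **The family step on a subspace.**  Let `hJ` hold for `u ∈ U`, all weights non-zero,
`|ι| ≤ 9`.  At `u = (a, β e₂ + γ e₃) ∈ U` with `a₀ a₁ β γ (a₂ γ + a₃ β) ≠ 0`, given `δ ∈ U` with
`δ.2 0 = 1`, `δ.2 1 = 0`, with `k = β e₂ - γ e₃`: either `t_r(u, (k, 0)) = 0` for all `r`, or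
`t_r(u, (0, k)) = 0` for all `r`. [folklore] -/
theorem family_step_U [CharZero K] [DecidableEq ι] (hι : Fintype.card ι ≤ 9) (c : ι → K)
    (hc : ∀ r, c r ≠ 0)
    (t : ι → (((Fin 4 → K) × (Fin 4 → K)) →ₗ[K] ((Fin 4 → K) × (Fin 4 → K)) →ₗ[K] K))
    (U : Submodule K ((Fin 4 → K) × (Fin 4 → K)))
    (hJ : ∀ u ∈ U, ∀ y₂ y₃ : Fin 4 → K,
      ∑ r, c r * (t r u (y₂, y₃)) ^ 2 = (Matrix.of ![u.1, u.2, y₂, y₃]).permanent)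
    (δ : (Fin 4 → K) × (Fin 4 → K)) (hδU : δ ∈ U) (hδ0 : δ.2 0 = 1) (hδ1 : δ.2 1 = 0)
    (a : Fin 4 → K) (β γ : K)
    (huU : ((a, β • Pi.single (2 : Fin 4) (1 : K) + γ • Pi.single 3 1) :
      (Fin 4 → K) × (Fin 4 → K)) ∈ U)
    (hgood : a 0 * a 1 * β * γ * (a 2 * γ + a 3 * β) ≠ 0) :
    (∀ r, t r (a, β • Pi.single (2 : Fin 4) (1 : K) + γ • Pi.single 3 1)
        (β • Pi.single (2 : Fin 4) (1 : K) - γ • Pi.single 3 1, 0) = 0) ∨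
    (∀ r, t r (a, β • Pi.single (2 : Fin 4) (1 : K) + γ • Pi.single 3 1)
        (0, β • Pi.single (2 : Fin 4) (1 : K) - γ • Pi.single 3 1) = 0) := by
  set b : Fin 4 → K := β • Pi.single (2 : Fin 4) (1 : K) + γ • Pi.single 3 1 with hb
  set k : Fin 4 → K := β • Pi.single (2 : Fin 4) (1 : K) - γ • Pi.single 3 1 with hk
  obtain ⟨⟨⟨⟨-, ha1⟩, hβ⟩, hγ⟩, -⟩ : (((¬a 0 = 0 ∧ ¬a 1 = 0) ∧ ¬β = 0) ∧ ¬γ = 0) ∧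
      ¬(a 2 * γ + a 3 * β) = 0 := by simpa only [ne_eq, mul_eq_zero, not_or] using hgood
  have hk0 : k ≠ 0 := fun h => by
    have : k 2 = 0 := by rw [h]; rfl
    simp [hk] at this
    exact hβ this
  have hb0 : b 0 = 0 := by simp [hb]
  have hb1 : b 1 = 0 := by simp [hb]
  -- polarisation at the point `u = (a, b) ∈ U`
  have hpol := polar_U c t U hJ (a, b) huU
  simp only at hpol
  -- `(k, 0)` and `(0, k)` are in the radical of the pairing at `u`
  have hrad : ∀ y₂' y₃' : Fin 4 → K, ∑ r, c r * t r (a, b) (k, 0) * t r (a, b) (y₂', y₃') = 0 := by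
    intro y₂' y₃'
    have h := hpol k 0 y₂' y₃'
    rw [hb, hk, per_family_kernel, ← hb, per_zero_row₃, add_zero] at h
    exact (mul_eq_zero.1 h).resolve_left two_ne_zero
  have hrad' : ∀ y₂' y₃' : Fin 4 → K, ∑ r, c r * t r (a, b) (0, k) * t r (a, b) (y₂', y₃') = 0 := by
    intro y₂' y₃'
    have h := hpol 0 k y₂' y₃'
    rw [per_zero_row₂, zero_add, ← per_swap_row₂₃, hb, hk, per_family_kernel] at h
    exact (mul_eq_zero.1 h).resolve_left two_ne_zero
  -- hence the forms `t_r(u, ·)` have a common non-trivial zero `w`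
  let Tu : ((Fin 4 → K) × (Fin 4 → K)) →ₗ[K] (ι → K) := LinearMap.pi fun r => t r (a, b)
  have hTu : ∀ y r, Tu y r = t r (a, b) y := fun y r => rfl
  have hker : LinearMap.ker Tu ≠ ⊥ :=
    ker_ne_bot_of_radical_pair hι c hc t (a, b) k hk0 (fun y' => hrad y'.1 y'.2)
      fun y' => hrad' y'.1 y'.2
  obtain ⟨w, hw, hw0⟩ := Submodule.exists_mem_ne_zero_of_ne_bot hker
  have hTw : ∀ r, t r (a, b) (w.1, w.2) = 0 := fun r => by
    rw [Prod.mk.eta, ← hTu]; exact congr_fun (LinearMap.mem_ker.1 hw) r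
  -- both halves of `w` are kernel vectors of the pairing, hence multiples of `k`
  have hw1 : ∀ v, (Matrix.of ![a, b, v, w.1]).permanent = 0 := by
    intro v
    have h := hpol w.1 w.2 0 v
    rw [per_zero_row₂, add_zero, show ∑ r, c r * t r (a, b) (w.1, w.2) * t r (a, b) (0, v) = 0
      from Finset.sum_eq_zero fun r _ => by rw [hTw, mul_zero, zero_mul], mul_zero] at h
    rw [← per_swap_row₂₃]; exact h.symm
  have hw2 : ∀ v, (Matrix.of ![a, b, v, w.2]).permanent = 0 := by
    intro v
    have h := hpol w.1 w.2 v 0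
    rw [per_zero_row₃, zero_add, show ∑ r, c r * t r (a, b) (w.1, w.2) * t r (a, b) (v, 0) = 0
      from Finset.sum_eq_zero fun r _ => by rw [hTw, mul_zero, zero_mul], mul_zero] at h
    exact h.symm
  have e1 := kernel_family a w.1 β γ hgood hw1
  have e2 := kernel_family a w.2 β γ hgood hw2
  rw [← hk] at e1 e2
  set α := w.1 2 / β
  set α' := w.2 2 / β
  -- differentiate `hJ` at `u` in the direction `δ ∈ U`
  have hd1 := hJ ((a, b) + δ) (U.add_mem huU hδU) w.1 w.2
  have hd2 := hJ δ hδU w.1 w.2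
  have hd0 := hJ (a, b) huU w.1 w.2
  have hsplit : ∀ r, t r ((a, b) + δ) (w.1, w.2) = t r δ (w.1, w.2) := fun r => by
    rw [map_add, LinearMap.add_apply, hTw r, zero_add]
  simp_rw [hsplit] at hd1
  simp only [Prod.fst_add, Prod.snd_add] at hd1
  have hsum : (Matrix.of ![a + δ.1, b + δ.2, w.1, w.2]).permanent =
      (Matrix.of ![a, b, w.1, w.2]).permanent + (Matrix.of ![a, δ.2, w.1, w.2]).permanent +
      (Matrix.of ![δ.1, b, w.1, w.2]).permanent + (Matrix.of ![δ.1, δ.2, w.1, w.2]).permanent := by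
    simp only [permanent_of_rows, Pi.add_apply]; ring
  rw [hsum] at hd1
  simp only at hd0
  simp_rw [hTw] at hd0
  simp only [ne_eq, OfNat.ofNat_ne_zero, not_false_eq_true, zero_pow, mul_zero,
    Finset.sum_const_zero] at hd0
  have hder : (Matrix.of ![a, δ.2, w.1, w.2]).permanent +
      (Matrix.of ![δ.1, b, w.1, w.2]).permanent = 0 := by
    linear_combination hd2 - hd1 + hd0
  rw [e1, e2] at hder
  simp only [per_smul_row₂, per_smul_row₃] at hder
  rw [hk, per_rows_kk, per_rows_kk, hδ0, hδ1, hb0, hb1] at hder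
  have hαα : α * α' = 0 := by
    have : α * α' * (-(2 * a 1 * β * γ)) = 0 := by linear_combination hder
    refine (mul_eq_zero.1 this).resolve_right ?_
    exact neg_ne_zero.2 (mul_ne_zero (mul_ne_zero (mul_ne_zero two_ne_zero ha1) hβ) hγ)
  rcases mul_eq_zero.1 hαα with h0 | h0
  · -- `w.1 = 0`, so `w = (0, α' k)` with `α' ≠ 0`
    right
    have hw1z : w.1 = 0 := by rw [e1, h0, zero_smul]
    have hα'0 : α' ≠ 0 := by
      intro h'
      apply hw0
      exact Prod.ext hw1z (by rw [e2, h', zero_smul]; rfl)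
    intro r
    have h := hTw r
    rw [hw1z, e2, show ((0 : Fin 4 → K), α' • k) = α' • ((0 : Fin 4 → K), k) by simp, map_smul,
      smul_eq_mul] at h
    exact (mul_eq_zero.1 h).resolve_left hα'0
  · left
    have hw2z : w.2 = 0 := by rw [e2, h0, zero_smul]
    have hα0 : α ≠ 0 := by
      intro h'
      apply hw0
      exact Prod.ext (by rw [e1, h', zero_smul]; rfl) hw2z
    intro r
    have h := hTw r
    rw [hw2z, e1, show ((α • k, (0 : Fin 4 → K)) : (Fin 4 → K) × (Fin 4 → K)) =
      α • (k, (0 : Fin 4 → K)) by simp, map_smul, smul_eq_mul] at h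
    exact (mul_eq_zero.1 h).resolve_left hα0


/-! ### From the family step to identities on the whole section `U ∩ {u.2 ∈ span(e₂, e₃)}` -/

/-- **The family alternative holds uniformly on the section.**  With `hJ` on `U`, all weights
non-zero, `|ι| ≤ 9`, a derivative direction `δ ∈ U` (`δ.2 0 = 1`, `δ.2 1 = 0`), and ONE point
`u ∈ U` with `u.2 ∈ span(e₂, e₃)` at which `u.1 0 · u.1 1 · u.2 2 · u.2 3 · (u.1 2 · u.2 3 + u.1 3 · u.2 2) ≠ 0`:
either `t_r(u, (u.2 2 • e₂ - u.2 3 • e₃, 0)) = 0` for ALL `u ∈ U` with `u.2 0 = u.2 1 = 0` and all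
`r`, or the same with the `y₃`-slot. [folklore] -/
theorem family₂₃_U [CharZero K] [DecidableEq ι] (hι : Fintype.card ι ≤ 9) (c : ι → K)
    (hc : ∀ r, c r ≠ 0)
    (t : ι → (((Fin 4 → K) × (Fin 4 → K)) →ₗ[K] ((Fin 4 → K) × (Fin 4 → K)) →ₗ[K] K))
    (U : Submodule K ((Fin 4 → K) × (Fin 4 → K)))
    (hJ : ∀ u ∈ U, ∀ y₂ y₃ : Fin 4 → K,
      ∑ r, c r * (t r u (y₂, y₃)) ^ 2 = (Matrix.of ![u.1, u.2, y₂, y₃]).permanent)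
    (δ : (Fin 4 → K) × (Fin 4 → K)) (hδU : δ ∈ U) (hδ0 : δ.2 0 = 1) (hδ1 : δ.2 1 = 0)
    (hpt : ∃ u ∈ U, u.2 0 = 0 ∧ u.2 1 = 0 ∧
      u.1 0 * u.1 1 * u.2 2 * u.2 3 * (u.1 2 * u.2 3 + u.1 3 * u.2 2) ≠ 0) :
    (∀ u ∈ U, u.2 0 = 0 → u.2 1 = 0 → ∀ r,
        t r u (u.2 2 • Pi.single (2 : Fin 4) (1 : K) - u.2 3 • Pi.single 3 1, 0) = 0) ∨
    (∀ u ∈ U, u.2 0 = 0 → u.2 1 = 0 → ∀ r,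
        t r u (0, u.2 2 • Pi.single (2 : Fin 4) (1 : K) - u.2 3 • Pi.single 3 1) = 0) := by
  -- linear parametrisation of the family by `P = (Fin 4 → K) × (K × K)`
  let L : (K × K) →ₗ[K] (Fin 4 → K) :=
    (LinearMap.fst K K K).smulRight (Pi.single 2 1) + (LinearMap.snd K K K).smulRight (Pi.single 3 1)
  let L' : (K × K) →ₗ[K] (Fin 4 → K) :=
    (LinearMap.fst K K K).smulRight (Pi.single 2 1) - (LinearMap.snd K K K).smulRight (Pi.single 3 1)
  let φ : ((Fin 4 → K) × (K × K)) →ₗ[K] ((Fin 4 → K) × (Fin 4 → K)) :=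
    (LinearMap.fst K (Fin 4 → K) (K × K)).prod (L ∘ₗ LinearMap.snd K (Fin 4 → K) (K × K))
  let ψ₂ : ((Fin 4 → K) × (K × K)) →ₗ[K] ((Fin 4 → K) × (Fin 4 → K)) :=
    LinearMap.inl K (Fin 4 → K) (Fin 4 → K) ∘ₗ L' ∘ₗ LinearMap.snd K (Fin 4 → K) (K × K)
  let ψ₃ : ((Fin 4 → K) × (K × K)) →ₗ[K] ((Fin 4 → K) × (Fin 4 → K)) :=
    LinearMap.inr K (Fin 4 → K) (Fin 4 → K) ∘ₗ L' ∘ₗ LinearMap.snd K (Fin 4 → K) (K × K)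
  have hφ : ∀ z, φ z = (z.1, z.2.1 • Pi.single (2 : Fin 4) (1 : K) + z.2.2 • Pi.single 3 1) :=
    fun z => rfl
  have hψ₂ : ∀ z, ψ₂ z = (z.2.1 • Pi.single (2 : Fin 4) (1 : K) - z.2.2 • Pi.single 3 1, 0) :=
    fun z => rfl
  have hψ₃ : ∀ z, ψ₃ z = (0, z.2.1 • Pi.single (2 : Fin 4) (1 : K) - z.2.2 • Pi.single 3 1) :=
    fun z => rfl
  -- the section `S = φ⁻¹(U)`
  let S : Submodule K ((Fin 4 → K) × (K × K)) := U.comap φ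
  have hS : ∀ u ∈ U, u.2 0 = 0 → u.2 1 = 0 → (u.1, (u.2 2, u.2 3)) ∈ S := by
    intro u hu h0 h1
    change φ (u.1, (u.2 2, u.2 3)) ∈ U
    rw [hφ]
    simp only
    rw [← eq_single_add_single u.2 h0 h1, Prod.mk.eta]
    exact hu
  have hSU : ∀ z ∈ S, ((z.1, z.2.1 • Pi.single (2 : Fin 4) (1 : K) + z.2.2 • Pi.single 3 1) :
      (Fin 4 → K) × (Fin 4 → K)) ∈ U := fun z hz => by
    rw [← hφ]; exact hz
  let f : ι → ((Fin 4 → K) × (K × K)) → K := fun r z => t r (φ z) (ψ₂ z)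
  let g : ι → ((Fin 4 → K) × (K × K)) → K := fun r z => t r (φ z) (ψ₃ z)
  let h : ((Fin 4 → K) × (K × K)) → K := fun z =>
    z.1 0 * z.1 1 * z.2.1 * z.2.2 * (z.1 2 * z.2.2 + z.1 3 * z.2.1)
  have key : ∀ r r', (∀ z ∈ S, f r z = 0) ∨ (∀ z ∈ S, g r' z = 0) := by
    intro r r'
    have H := forall_eq_zero_or_of_mul₃ S (f := f r) (g := g r') (h := h)
      (linePoly_bilin (t r) φ ψ₂) (linePoly_bilin (t r') φ ψ₃) linePoly_good (by
        intro z hz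
        by_cases hz0 : h z = 0
        · rw [hz0, mul_zero]
        · rcases family_step_U hι c hc t U hJ δ hδU hδ0 hδ1 z.1 z.2.1 z.2.2 (hSU z hz) hz0
            with H | H
          · rw [show f r z = 0 from H r, zero_mul, zero_mul]
          · rw [show g r' z = 0 from H r', mul_zero, zero_mul])
    rcases H with H | H | H
    · exact Or.inl H
    · exact Or.inr H
    · exfalso
      obtain ⟨u, hu, h0, h1, hne⟩ := hpt
      exact hne (H _ (hS u hu h0 h1))
  by_cases hB : ∀ r', ∀ z ∈ S, g r' z = 0
  · right
    intro u hu h0 h1 r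
    have := hB r _ (hS u hu h0 h1)
    simp only [g, hφ, hψ₃] at this
    rwa [← eq_single_add_single u.2 h0 h1, Prod.mk.eta] at this
  · push Not at hB
    obtain ⟨r', z', hz', hne⟩ := hB
    left
    intro u hu h0 h1 r
    rcases key r r' with H | H
    · have := H _ (hS u hu h0 h1)
      simp only [f, hφ, hψ₂] at this
      rwa [← eq_single_add_single u.2 h0 h1, Prod.mk.eta] at this
    · exact absurd (H z' hz') hne

/-! ### Column bookkeeping relative to a section `ρ` of the second projection -/

omit [Fintype ι] in
/-- **Column identities from the first family alternative on `U`.**  Let `ρ : K⁴ → K⁴ × K⁴` be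
linear with `(ρ b).2 = b` and `ρ b ∈ U`.  If `t_r(u, (u.2 2 • e₂ - u.2 3 • e₃, 0)) = 0` for all
`u ∈ U` with `u.2 0 = u.2 1 = 0`, then `t_r((a, 0), (e₂, 0)) = t_r((a, 0), (e₃, 0)) = 0` whenever
`(a, 0) ∈ U`, and `t_r(ρ e₂, (e₂, 0)) = t_r(ρ e₃, (e₃, 0)) = 0`. [folklore] -/
theorem columns_of_caseA_U
    (t : ι → (((Fin 4 → K) × (Fin 4 → K)) →ₗ[K] ((Fin 4 → K) × (Fin 4 → K)) →ₗ[K] K))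
    (U : Submodule K ((Fin 4 → K) × (Fin 4 → K)))
    (ρ : (Fin 4 → K) →ₗ[K] ((Fin 4 → K) × (Fin 4 → K))) (hρ2 : ∀ b, (ρ b).2 = b)
    (hρU : ∀ b, ρ b ∈ U)
    (hA : ∀ u ∈ U, u.2 0 = 0 → u.2 1 = 0 → ∀ r,
        t r u (u.2 2 • Pi.single (2 : Fin 4) (1 : K) - u.2 3 • Pi.single 3 1, 0) = 0) :
    (∀ a : Fin 4 → K, ((a, (0 : Fin 4 → K)) : (Fin 4 → K) × (Fin 4 → K)) ∈ U →
        ∀ r, t r (a, 0) (Pi.single 2 1, 0) = 0) ∧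
    (∀ a : Fin 4 → K, ((a, (0 : Fin 4 → K)) : (Fin 4 → K) × (Fin 4 → K)) ∈ U →
        ∀ r, t r (a, 0) (Pi.single 3 1, 0) = 0) ∧
    (∀ r, t r (ρ (Pi.single 2 1)) (Pi.single 2 1, 0) = 0) ∧
    (∀ r, t r (ρ (Pi.single 3 1)) (Pi.single 3 1, 0) = 0) := by
  have h22 : (ρ (Pi.single 2 1)).2 2 = 1 := by simp [hρ2]
  have h23 : (ρ (Pi.single 2 1)).2 3 = 0 := by simp [hρ2]
  have h20 : (ρ (Pi.single 2 1)).2 0 = 0 := by simp [hρ2]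
  have h21 : (ρ (Pi.single 2 1)).2 1 = 0 := by simp [hρ2]
  have h32 : (ρ (Pi.single 3 1)).2 2 = 0 := by simp [hρ2]
  have h33 : (ρ (Pi.single 3 1)).2 3 = 1 := by simp [hρ2]
  have h30 : (ρ (Pi.single 3 1)).2 0 = 0 := by simp [hρ2]
  have h31 : (ρ (Pi.single 3 1)).2 1 = 0 := by simp [hρ2]
  have n2 : ∀ r, t r (ρ (Pi.single 2 1)) (Pi.single 2 1, 0) = 0 := fun r => by
    have := hA _ (hρU (Pi.single 2 1)) h20 h21 r
    rwa [h22, h23, one_smul, zero_smul, sub_zero] at this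
  have n3 : ∀ r, t r (ρ (Pi.single 3 1)) (Pi.single 3 1, 0) = 0 := fun r => by
    have := hA _ (hρU (Pi.single 3 1)) h30 h31 r
    rw [h32, h33, one_smul, zero_smul, zero_sub,
      show ((-(Pi.single 3 1 : Fin 4 → K)), (0 : Fin 4 → K)) =
        -(((Pi.single 3 1 : Fin 4 → K)), (0 : Fin 4 → K)) by simp, map_neg, neg_eq_zero] at this
    exact this
  refine ⟨fun a ha r => ?_, fun a ha r => ?_, n2, n3⟩
  · have hu : ((a, (0 : Fin 4 → K)) : (Fin 4 → K) × (Fin 4 → K)) + ρ (Pi.single 2 1) ∈ U :=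
      U.add_mem ha (hρU _)
    have := hA _ hu (by simp [h20]) (by simp [h21]) r
    rw [map_add, LinearMap.add_apply] at this
    simpa [h22, h23, n2 r] using this
  · have hu : ((a, (0 : Fin 4 → K)) : (Fin 4 → K) × (Fin 4 → K)) + ρ (Pi.single 3 1) ∈ U :=
      U.add_mem ha (hρU _)
    have := hA _ hu (by simp [h30]) (by simp [h31]) r
    rw [map_add, LinearMap.add_apply] at this
    have e : ((-(Pi.single 3 1 : Fin 4 → K)), (0 : Fin 4 → K)) =
        -(((Pi.single 3 1 : Fin 4 → K)), (0 : Fin 4 → K)) := by simp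
    simp only [Prod.snd_add, Pi.add_apply, Pi.zero_apply, zero_add, h32, h33, zero_smul,
      one_smul, zero_sub] at this
    rw [e, map_neg, map_neg, n3 r, neg_zero, add_zero, neg_eq_zero] at this
    exact this

omit [Fintype ι] in
/-- **Column identities from the second family alternative on `U`** (the `y₃`-slot version of
`columns_of_caseA_U`). [folklore] -/
theorem columns_of_caseB_U
    (t : ι → (((Fin 4 → K) × (Fin 4 → K)) →ₗ[K] ((Fin 4 → K) × (Fin 4 → K)) →ₗ[K] K))
    (U : Submodule K ((Fin 4 → K) × (Fin 4 → K)))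
    (ρ : (Fin 4 → K) →ₗ[K] ((Fin 4 → K) × (Fin 4 → K))) (hρ2 : ∀ b, (ρ b).2 = b)
    (hρU : ∀ b, ρ b ∈ U)
    (hB : ∀ u ∈ U, u.2 0 = 0 → u.2 1 = 0 → ∀ r,
        t r u (0, u.2 2 • Pi.single (2 : Fin 4) (1 : K) - u.2 3 • Pi.single 3 1) = 0) :
    (∀ a : Fin 4 → K, ((a, (0 : Fin 4 → K)) : (Fin 4 → K) × (Fin 4 → K)) ∈ U →
        ∀ r, t r (a, 0) (0, Pi.single 2 1) = 0) ∧
    (∀ a : Fin 4 → K, ((a, (0 : Fin 4 → K)) : (Fin 4 → K) × (Fin 4 → K)) ∈ U →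
        ∀ r, t r (a, 0) (0, Pi.single 3 1) = 0) ∧
    (∀ r, t r (ρ (Pi.single 2 1)) (0, Pi.single 2 1) = 0) ∧
    (∀ r, t r (ρ (Pi.single 3 1)) (0, Pi.single 3 1) = 0) := by
  have h22 : (ρ (Pi.single 2 1)).2 2 = 1 := by simp [hρ2]
  have h23 : (ρ (Pi.single 2 1)).2 3 = 0 := by simp [hρ2]
  have h20 : (ρ (Pi.single 2 1)).2 0 = 0 := by simp [hρ2]
  have h21 : (ρ (Pi.single 2 1)).2 1 = 0 := by simp [hρ2]
  have h32 : (ρ (Pi.single 3 1)).2 2 = 0 := by simp [hρ2]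
  have h33 : (ρ (Pi.single 3 1)).2 3 = 1 := by simp [hρ2]
  have h30 : (ρ (Pi.single 3 1)).2 0 = 0 := by simp [hρ2]
  have h31 : (ρ (Pi.single 3 1)).2 1 = 0 := by simp [hρ2]
  have n2 : ∀ r, t r (ρ (Pi.single 2 1)) (0, Pi.single 2 1) = 0 := fun r => by
    have := hB _ (hρU (Pi.single 2 1)) h20 h21 r
    rwa [h22, h23, one_smul, zero_smul, sub_zero] at this
  have n3 : ∀ r, t r (ρ (Pi.single 3 1)) (0, Pi.single 3 1) = 0 := fun r => by
    have := hB _ (hρU (Pi.single 3 1)) h30 h31 r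
    rw [h32, h33, one_smul, zero_smul, zero_sub,
      show (((0 : Fin 4 → K)), (-(Pi.single 3 1 : Fin 4 → K))) =
        -(((0 : Fin 4 → K)), ((Pi.single 3 1 : Fin 4 → K))) by simp, map_neg, neg_eq_zero] at this
    exact this
  refine ⟨fun a ha r => ?_, fun a ha r => ?_, n2, n3⟩
  · have hu : ((a, (0 : Fin 4 → K)) : (Fin 4 → K) × (Fin 4 → K)) + ρ (Pi.single 2 1) ∈ U :=
      U.add_mem ha (hρU _)
    have := hB _ hu (by simp [h20]) (by simp [h21]) r
    rw [map_add, LinearMap.add_apply] at this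
    simpa [h22, h23, n2 r] using this
  · have hu : ((a, (0 : Fin 4 → K)) : (Fin 4 → K) × (Fin 4 → K)) + ρ (Pi.single 3 1) ∈ U :=
      U.add_mem ha (hρU _)
    have := hB _ hu (by simp [h30]) (by simp [h31]) r
    rw [map_add, LinearMap.add_apply] at this
    have e : (((0 : Fin 4 → K)), (-(Pi.single 3 1 : Fin 4 → K))) =
        -(((0 : Fin 4 → K)), ((Pi.single 3 1 : Fin 4 → K))) := by simp
    simp only [Prod.snd_add, Pi.add_apply, Pi.zero_apply, zero_add, h32, h33, zero_smul,
      one_smul, zero_sub] at this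
    rw [e, map_neg, map_neg, n3 r, neg_zero, add_zero, neg_eq_zero] at this
    exact this

end Summit.ValiantsHypothesis.ValiantsHypothesis.Theorems.SymPencilPerFourInnerRankHypFamily

end
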